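import Literature.Analysis.FluidPDE.SourcedScalarBudget

/-!
# Condensate theorem, stub B: the mean toolkit

Four elementary facts about the double Cesàro integral `∫₀ᵀ ∫₀ᵗ F(τ) dτ dt` of a weak sourced
passive scalar `θ` (`θ ∈ L^∞_t L²_x`, `uθ ∈ L¹_{t,x}`, `Torus.IsWeakScalarTransportForced`) on
the two-torus, used by the condensate theorem of the crux `TwohalfdNeg`:

* (B1) boundary averages of `∫ θ ψ` against a bounded `ψ` are `O(T + ∫₀ᵀ ‖θ‖²)`
  (`|θψ| ≤ C|θ| ≤ C(1 + θ²)/2`);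
* (B2) the double-mean flux through the drift `u` differs from the flux through a steady field `V`
  by at most `C/2 (λ ∫∫‖θ‖² + λ⁻¹ ∫∫‖u − V‖²)` (`θ(⟪u,∇φ⟫ + κΔφ) − θ⟪V,∇φ⟫ − κθΔφ = θ⟪u − V,∇φ⟫`
  and `2|θ|‖u − V‖ ≤ λθ² + λ⁻¹‖u − V‖²`);
* (B3) the triangle Fubini identity `∫₀ᵀ ∫₀ᵗ F = ∫₀ᵀ (T − τ) F(τ) dτ`;
* (B4) `∫₀ᵀ ∫₀ᵗ F ≤ T ∫₀ᵀ F` for `F ≥ 0`.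
-/

namespace Summit.AnomalousDissipation.AnomalousDissipation.Theorems.TwohalfdNeg.Condensate

open MeasureTheory Filter Topology
open scoped ENNReal NNReal InnerProductSpace
open Literature.Analysis.FunctionSpaces Literature.Analysis.FluidPDE

set_option linter.dupNamespace false

/-! ## Double time integrals `∫₀ᵀ ∫₀ᵗ` of integrable functions -/

/-- A function integrable on `(0, T]` is interval integrable on `[0, t]` for `0 ≤ t ≤ T`.
[folklore] -/
theorem meanToolkit_intervalIntegrable_of_le {f : ℝ → ℝ} {T t : ℝ} (ht : 0 ≤ t) (htT : t ≤ T)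
    (hf : IntegrableOn f (Set.Ioc 0 T) volume) : IntervalIntegrable f volume 0 t :=
  (intervalIntegrable_iff_integrableOn_Ioc_of_le ht).2 (hf.mono_set (Set.Ioc_subset_Ioc_right htT))

/-- The primitive `t ↦ ∫₀ᵗ f` of a function integrable on `(0, T]` is interval integrable on
`[0, T]` (it is continuous there). [folklore] -/
theorem meanToolkit_intervalIntegrable_primitive {f : ℝ → ℝ} {T : ℝ} (hT : 0 ≤ T)
    (hf : IntegrableOn f (Set.Ioc 0 T) volume) :
    IntervalIntegrable (fun t => ∫ τ in (0 : ℝ)..t, f τ) volume 0 T :=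
  (intervalIntegral.continuousOn_primitive_interval'
    (meanToolkit_intervalIntegrable_of_le hT le_rfl hf) Set.left_mem_uIcc).intervalIntegrable

/-- Constants come out of the double integral: `∫₀ᵀ∫₀ᵗ c F = c ∫₀ᵀ∫₀ᵗ F`. [folklore] -/
theorem meanToolkit_double_const_mul (c : ℝ) (f : ℝ → ℝ) (T : ℝ) :
    ∫ t in (0 : ℝ)..T, ∫ τ in (0 : ℝ)..t, c * f τ = c * ∫ t in (0 : ℝ)..T, ∫ τ in (0 : ℝ)..t, f τ := by
  rw [← intervalIntegral.integral_const_mul]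
  exact intervalIntegral.integral_congr fun t _ => intervalIntegral.integral_const_mul c f

/-- Additivity of the double integral `∫₀ᵀ∫₀ᵗ` over functions integrable on `(0, T]`. [folklore] -/
theorem meanToolkit_double_add {f g : ℝ → ℝ} {T : ℝ} (hT : 0 ≤ T)
    (hf : IntegrableOn f (Set.Ioc 0 T) volume) (hg : IntegrableOn g (Set.Ioc 0 T) volume) :
    ∫ t in (0 : ℝ)..T, ∫ τ in (0 : ℝ)..t, (f τ + g τ) =
      (∫ t in (0 : ℝ)..T, ∫ τ in (0 : ℝ)..t, f τ) + ∫ t in (0 : ℝ)..T, ∫ τ in (0 : ℝ)..t, g τ := by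
  rw [← intervalIntegral.integral_add (meanToolkit_intervalIntegrable_primitive hT hf)
    (meanToolkit_intervalIntegrable_primitive hT hg)]
  refine intervalIntegral.integral_congr fun t ht => ?_
  rw [Set.uIcc_of_le hT] at ht
  exact intervalIntegral.integral_add (meanToolkit_intervalIntegrable_of_le ht.1 ht.2 hf)
    (meanToolkit_intervalIntegrable_of_le ht.1 ht.2 hg)

/-- The double integral `∫₀ᵀ∫₀ᵗ` of a difference of functions integrable on `(0, T]`.
[folklore] -/
theorem meanToolkit_double_sub {f g : ℝ → ℝ} {T : ℝ} (hT : 0 ≤ T)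
    (hf : IntegrableOn f (Set.Ioc 0 T) volume) (hg : IntegrableOn g (Set.Ioc 0 T) volume) :
    ∫ t in (0 : ℝ)..T, ∫ τ in (0 : ℝ)..t, (f τ - g τ) =
      (∫ t in (0 : ℝ)..T, ∫ τ in (0 : ℝ)..t, f τ) - ∫ t in (0 : ℝ)..T, ∫ τ in (0 : ℝ)..t, g τ := by
  rw [← intervalIntegral.integral_sub (meanToolkit_intervalIntegrable_primitive hT hf)
    (meanToolkit_intervalIntegrable_primitive hT hg)]
  refine intervalIntegral.integral_congr fun t ht => ?_
  rw [Set.uIcc_of_le hT] at ht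
  exact intervalIntegral.integral_sub (meanToolkit_intervalIntegrable_of_le ht.1 ht.2 hf)
    (meanToolkit_intervalIntegrable_of_le ht.1 ht.2 hg)

/-- The double integral `∫₀ᵀ∫₀ᵗ` only sees the integrand a.e. on `(0, T]`. [folklore] -/
theorem meanToolkit_double_congr_ae {f g : ℝ → ℝ} {T : ℝ} (hT : 0 ≤ T)
    (h : ∀ᵐ τ ∂(volume.restrict (Set.Ioc 0 T)), f τ = g τ) :
    ∫ t in (0 : ℝ)..T, ∫ τ in (0 : ℝ)..t, f τ = ∫ t in (0 : ℝ)..T, ∫ τ in (0 : ℝ)..t, g τ := by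
  have h' := (ae_restrict_iff' (measurableSet_Ioc (a := (0 : ℝ)) (b := T))).1 h
  refine intervalIntegral.integral_congr fun t ht => ?_
  rw [Set.uIcc_of_le hT] at ht
  refine intervalIntegral.integral_congr_ae ?_
  rw [Set.uIoc_of_le ht.1]
  exact h'.mono fun τ hτ hτt => hτ ⟨hτt.1, hτt.2.trans ht.2⟩

/-- **Comparison of double integrals**: if `‖e‖ ≤ M` a.e. on `(0, T]` with `M` integrable there,
then `‖∫₀ᵀ∫₀ᵗ e‖ ≤ ∫₀ᵀ∫₀ᵗ M`. [folklore] -/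
theorem meanToolkit_double_norm_le {e M : ℝ → ℝ} {T : ℝ} (hT : 0 ≤ T)
    (hM : IntegrableOn M (Set.Ioc 0 T) volume)
    (h : ∀ᵐ τ ∂(volume.restrict (Set.Ioc 0 T)), ‖e τ‖ ≤ M τ) :
    ‖∫ t in (0 : ℝ)..T, ∫ τ in (0 : ℝ)..t, e τ‖ ≤ ∫ t in (0 : ℝ)..T, ∫ τ in (0 : ℝ)..t, M τ := by
  have h' := (ae_restrict_iff' (measurableSet_Ioc (a := (0 : ℝ)) (b := T))).1 h
  refine intervalIntegral.norm_integral_le_of_norm_le hT (Eventually.of_forall fun t ht => ?_)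
    (meanToolkit_intervalIntegrable_primitive hT hM)
  exact intervalIntegral.norm_integral_le_of_norm_le ht.1.le
    (h'.mono fun τ hτ hτt => hτ ⟨hτt.1, hτt.2.trans ht.2⟩)
    (meanToolkit_intervalIntegrable_of_le ht.1.le ht.2 hM)

/-! ## (B3) and (B4): triangle Fubini and the crude bound -/

/-- **(B3) Triangle Fubini**: for `F` integrable on `(0, T]`,
`∫₀ᵀ (∫₀ᵗ F) dt = ∫₀ᵀ (T − τ) F(τ) dτ` (Fubini on the triangle `{0 < τ ≤ t ≤ T}`, in the form
`∫ f ∫g + ∫ g ∫f = ∫f ∫g` of `setIntegral_mul_setIntegral_add_symm` with `f = 1`, `g = F`).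
[folklore] -/
theorem meanToolkit_b3 : ∀ (F : ℝ → ℝ) (T : ℝ), 0 ≤ T → IntervalIntegrable F volume 0 T →
    ∫ t in (0 : ℝ)..T, ∫ τ in (0 : ℝ)..t, F τ = ∫ τ in (0 : ℝ)..T, (T - τ) * F τ := by
  intro F T hT hF
  have hFi : IntegrableOn F (Set.Ioc 0 T) volume := (intervalIntegrable_iff_integrableOn_Ioc_of_le hT).1 hF
  have h1 : IntegrableOn (fun _ => (1 : ℝ)) (Set.Ioc 0 T) volume := integrableOn_const measure_Ioc_lt_top.ne
  have key := setIntegral_mul_setIntegral_add_symm h1 hFi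
  have e2 : ∫ _ in Set.Ioc 0 T, (1 : ℝ) = T := by
    rw [setIntegral_const, Real.volume_real_Ioc_of_le hT, sub_zero, smul_eq_mul, mul_one]
  have e3 : ∫ r in Set.Ioc 0 T, F r * ∫ _ in Set.Ioc 0 r, (1 : ℝ) = ∫ r in Set.Ioc 0 T, r * F r := by
    refine setIntegral_congr_fun measurableSet_Ioc fun r hr => ?_
    rw [setIntegral_const, Real.volume_real_Ioc_of_le hr.1.le, sub_zero, smul_eq_mul, mul_one, mul_comm]
  have e4 : ∫ t in Set.Ioc 0 T, ∫ τ in (0 : ℝ)..t, F τ = ∫ t in Set.Ioc 0 T, ∫ τ in Set.Ioc 0 t, F τ :=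
    setIntegral_congr_fun measurableSet_Ioc fun t ht => by rw [intervalIntegral.integral_of_le ht.1.le]
  have hrF : IntervalIntegrable (fun r => r * F r) volume 0 T := hF.continuousOn_mul continuousOn_id
  have e5 : ∫ τ in (0 : ℝ)..T, (T - τ) * F τ =
      T * (∫ τ in (0 : ℝ)..T, F τ) - ∫ τ in (0 : ℝ)..T, τ * F τ := by
    have e : (fun τ => (T - τ) * F τ) = fun τ => T * F τ - τ * F τ := by
      funext τ; ring
    rw [e, intervalIntegral.integral_sub (hF.const_mul T) hrF, intervalIntegral.integral_const_mul]
  rw [e5, intervalIntegral.integral_of_le hT, intervalIntegral.integral_of_le hT,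
    intervalIntegral.integral_of_le hT, e4]
  simp only [one_mul] at key
  rw [e2, e3] at key
  linarith

/-- **(B4)**: for `F ≥ 0` integrable on `(0, T]`, `∫₀ᵀ ∫₀ᵗ F ≤ T ∫₀ᵀ F`
(by (B3), `(T − τ) F(τ) ≤ T F(τ)` on `[0, T]`). [folklore] -/
theorem meanToolkit_b4 : ∀ (F : ℝ → ℝ) (T : ℝ), 0 ≤ T → IntervalIntegrable F volume 0 T →
    (∀ τ, 0 ≤ F τ) →
    ∫ t in (0 : ℝ)..T, ∫ τ in (0 : ℝ)..t, F τ ≤ T * ∫ τ in (0 : ℝ)..T, F τ := by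
  intro F T hT hF hF0
  have hg : IntervalIntegrable (fun τ => (T - τ) * F τ) volume 0 T :=
    hF.continuousOn_mul (continuousOn_const.sub continuousOn_id)
  rw [meanToolkit_b3 F T hT hF, ← intervalIntegral.integral_const_mul]
  exact intervalIntegral.integral_mono_on hT hg (hF.const_mul T) fun τ hτ =>
    mul_le_mul_of_nonneg_right (by linarith [hτ.1]) (hF0 τ)

/-! ## (B1): boundary averages against a bounded test function -/

/-- **(B1)**: for a global weak sourced scalar `θ` and a test function `ψ` with `|ψ| ≤ C`,
`|∫₀ᵀ ∫θ(t)ψ dt| ≤ C (T + ∫₀ᵀ ‖θ‖²)/2` and `|∫₀ᵀ ∫₀ᵗ ∫θ(τ)ψ dτ dt| ≤ T · C (T + ∫₀ᵀ ‖θ‖²)/2`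
(`|θψ| ≤ C|θ| ≤ C(1 + θ²)/2` pointwise, `θ(t) ∈ L²` for a.e. `t`, and `∫₀ᵗ ≤ ∫₀ᵀ` of the
nonnegative majorant). [folklore] -/
theorem meanToolkit_b1 :
    ∀ (κ T C : ℝ) (u : ℝ → UnitAddTorus (Fin 2) → EuclideanSpace ℝ (Fin 2))
      (h θ₀ : UnitAddTorus (Fin 2) → ℝ) (θ : ℝ → UnitAddTorus (Fin 2) → ℝ)
      (ψ : UnitAddTorus (Fin 2) → ℝ),
      0 < T → Torus.IsWeakScalarTransportForced κ u (fun _ => h) θ₀ θ → Continuous ψ →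
      (∀ x, |ψ x| ≤ C) →
      |∫ t in (0 : ℝ)..T, ∫ x, θ t x * ψ x| ≤ C * (T + ∫ t in (0 : ℝ)..T, Torus.scalarL2Sq (θ t)) / 2 ∧
      |∫ t in (0 : ℝ)..T, ∫ τ in (0 : ℝ)..t, ∫ x, θ τ x * ψ x| ≤
        T * (C * (T + ∫ t in (0 : ℝ)..T, Torus.scalarL2Sq (θ t)) / 2) := by
  intro κ T C u h θ₀ θ ψ hT hθ _hψ hψC
  have hW := hθ T hT
  have hC0 : 0 ≤ C := (abs_nonneg _).trans (hψC 0)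
  have hSi : IntegrableOn (fun t => Torus.scalarL2Sq (θ t)) (Set.Ioc 0 T) volume :=
    (Torus.integrableOn_scalarL2Sq hθ hT).1
  -- the majorant `C (1 + ‖θ(t)‖²)/2` is integrable on `(0, T]`
  have hgi : IntegrableOn (fun t => C * (1 + Torus.scalarL2Sq (θ t)) / 2) (Set.Ioc 0 T) volume :=
    (((integrableOn_const measure_Ioc_lt_top.ne).add hSi).const_mul C).div_const 2
  -- and dominates `∫ θ(t) ψ` for a.e. `t`
  have hae : ∀ᵐ t ∂(volume.restrict (Set.Ioc 0 T)),
      ‖∫ x, θ t x * ψ x‖ ≤ C * (1 + Torus.scalarL2Sq (θ t)) / 2 := by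
    rw [← Measure.restrict_congr_set (Ioo_ae_eq_Ioc (a := (0 : ℝ)) (b := T))]
    filter_upwards [hW.ae_memLp_two] with t hm2
    have hθ2 : Integrable (fun x => θ t x ^ 2) volume := hm2.integrable_sq
    rw [Real.norm_eq_abs]
    calc |∫ x, θ t x * ψ x| ≤ ∫ x, |θ t x * ψ x| := abs_integral_le_integral_abs
      _ ≤ ∫ x, C * (1 + θ t x ^ 2) / 2 :=
          integral_mono_of_nonneg (Eventually.of_forall fun x => abs_nonneg _)
            ((((integrable_const (1 : ℝ)).add hθ2).const_mul C).div_const 2)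
            (Eventually.of_forall fun x => by
              have h2 : 2 * |θ t x| ≤ 1 + θ t x ^ 2 := by
                nlinarith [sq_nonneg (|θ t x| - 1), sq_abs (θ t x)]
              calc |θ t x * ψ x| = |θ t x| * |ψ x| := abs_mul _ _
                _ ≤ |θ t x| * C := mul_le_mul_of_nonneg_left (hψC x) (abs_nonneg _)
                _ = C / 2 * (2 * |θ t x|) := by ring
                _ ≤ C / 2 * (1 + θ t x ^ 2) := mul_le_mul_of_nonneg_left h2 (by positivity)
                _ = C * (1 + θ t x ^ 2) / 2 := by ring)
      _ = C * (1 + Torus.scalarL2Sq (θ t)) / 2 := by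
          rw [integral_div, MeasureTheory.integral_const_mul, integral_add (integrable_const _) hθ2,
            integral_const, Torus.scalarL2Sq]
          simp only [probReal_univ, smul_eq_mul, one_mul]
  have hae' := (ae_restrict_iff' (measurableSet_Ioc (a := (0 : ℝ)) (b := T))).1 hae
  -- the value of the integrated majorant
  have hgT : ∫ t in (0 : ℝ)..T, C * (1 + Torus.scalarL2Sq (θ t)) / 2 =
      C * (T + ∫ t in (0 : ℝ)..T, Torus.scalarL2Sq (θ t)) / 2 := by
    rw [intervalIntegral.integral_div, intervalIntegral.integral_const_mul,
      intervalIntegral.integral_add intervalIntegrable_const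
        (meanToolkit_intervalIntegrable_of_le hT.le le_rfl hSi),
      intervalIntegral.integral_const, smul_eq_mul, sub_zero, mul_one]
  -- uniform bound of the primitives `∫₀ᵗ ∫θψ`, `0 ≤ t ≤ T`
  have hP : ∀ t, 0 ≤ t → t ≤ T → ‖∫ τ in (0 : ℝ)..t, ∫ x, θ τ x * ψ x‖ ≤
      C * (T + ∫ t in (0 : ℝ)..T, Torus.scalarL2Sq (θ t)) / 2 := by
    intro t ht htT
    calc ‖∫ τ in (0 : ℝ)..t, ∫ x, θ τ x * ψ x‖
        ≤ ∫ τ in (0 : ℝ)..t, C * (1 + Torus.scalarL2Sq (θ τ)) / 2 :=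
          intervalIntegral.norm_integral_le_of_norm_le ht
            (hae'.mono fun τ hτ hτt => hτ ⟨hτt.1, hτt.2.trans htT⟩)
            (meanToolkit_intervalIntegrable_of_le ht htT hgi)
      _ ≤ ∫ τ in (0 : ℝ)..T, C * (1 + Torus.scalarL2Sq (θ τ)) / 2 :=
          intervalIntegral.integral_mono_interval le_rfl ht htT
            (Eventually.of_forall fun τ => by
              have := Torus.scalarL2Sq_nonneg (θ τ)
              positivity)
            (meanToolkit_intervalIntegrable_of_le hT.le le_rfl hgi)
      _ = C * (T + ∫ t in (0 : ℝ)..T, Torus.scalarL2Sq (θ t)) / 2 := hgT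
  refine ⟨?_, ?_⟩
  · have h1 := hP T hT.le le_rfl
    rwa [Real.norm_eq_abs] at h1
  · have h2 := intervalIntegral.norm_integral_le_of_norm_le_const (a := 0) (b := T)
      (C := C * (T + ∫ t in (0 : ℝ)..T, Torus.scalarL2Sq (θ t)) / 2)
      (f := fun t => ∫ τ in (0 : ℝ)..t, ∫ x, θ τ x * ψ x) fun t ht => by
        rw [Set.uIoc_of_le hT.le] at ht
        exact hP t ht.1.le ht.2
    rw [Real.norm_eq_abs, sub_zero, abs_of_pos hT] at h2
    exact h2.trans_eq (mul_comm _ _)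

/-! ## (B2): the flux through the drift versus the flux through a steady field -/

/-- **(B2)**: for a global weak sourced scalar `θ`, a continuous steady field `V`, a smooth `φ`
with `‖∇φ‖ ≤ C`, `λ > 0`, and `∫‖u(τ) − V‖²` integrable on `(0, T]`,
`|∫∫ ∫θ(⟪u,∇φ⟫ + κΔφ) − ∫∫ ∫θ⟪V,∇φ⟫ − κ ∫∫ ∫θΔφ| ≤ C/2 (λ ∫∫‖θ‖² + λ⁻¹ ∫∫ ∫‖u − V‖²)`
(all double integrals `∫₀ᵀ∫₀ᵗ`): the integrand of the difference is `∫ θ⟪u − V, ∇φ⟫` for a.e.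
`τ`, bounded by `C ∫|θ|‖u − V‖ ≤ C/2 (λ‖θ‖² + λ⁻¹‖u − V‖²)`. [folklore] -/
theorem meanToolkit_b2 :
    ∀ (κ T C lam : ℝ) (u : ℝ → UnitAddTorus (Fin 2) → EuclideanSpace ℝ (Fin 2))
      (V : UnitAddTorus (Fin 2) → EuclideanSpace ℝ (Fin 2))
      (h θ₀ : UnitAddTorus (Fin 2) → ℝ) (θ : ℝ → UnitAddTorus (Fin 2) → ℝ)
      (φ : UnitAddTorus (Fin 2) → ℝ),
      0 < T → 0 < lam → Torus.IsWeakScalarTransportForced κ u (fun _ => h) θ₀ θ → Continuous V →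
      Torus.IsSmooth φ → (∀ x, ‖Torus.gradient φ x‖ ≤ C) →
      IntegrableOn (fun τ => ∫ x, ‖u τ x - V x‖ ^ 2) (Set.Ioc 0 T) →
      |(∫ t in (0 : ℝ)..T, ∫ τ in (0 : ℝ)..t, ∫ x, θ τ x *
          (inner ℝ (u τ x) (Torus.gradient φ x) + κ * Torus.laplacian φ x)) -
        (∫ t in (0 : ℝ)..T, ∫ τ in (0 : ℝ)..t, ∫ x, θ τ x * inner ℝ (V x) (Torus.gradient φ x)) -
        κ * (∫ t in (0 : ℝ)..T, ∫ τ in (0 : ℝ)..t, ∫ x, θ τ x * Torus.laplacian φ x)| ≤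
        C / 2 * (lam * (∫ t in (0 : ℝ)..T, ∫ τ in (0 : ℝ)..t, Torus.scalarL2Sq (θ τ)) +
          lam⁻¹ * (∫ t in (0 : ℝ)..T, ∫ τ in (0 : ℝ)..t, ∫ x, ‖u τ x - V x‖ ^ 2)) := by
  intro κ T C lam u V h θ₀ θ φ hT hlam hθ hV hφ hC hWi
  have hW := hθ T hT
  have hC0 : 0 ≤ C := (norm_nonneg _).trans (hC 0)
  have hVg : Continuous fun x => inner ℝ (V x) (Torus.gradient φ x) := hV.inner hφ.gradient.continuous
  -- joint integrability of the three flux integrands on `(0,T) × T²`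
  have iA := hW.integrable_mul_steadyFlux hφ
  have iB := hW.integrable_mul_continuous hVg
  have iD := hW.integrable_mul_continuous hφ.laplacian.continuous
  -- hence integrability in time of their space integrals
  have hA : IntegrableOn (fun τ => ∫ x, θ τ x *
      (inner ℝ (u τ x) (Torus.gradient φ x) + κ * Torus.laplacian φ x)) (Set.Ioc 0 T) volume :=
    IntegrableOn.congr_set_ae iA.integral_prod_left Ioo_ae_eq_Ioc.symm
  have hB : IntegrableOn (fun τ => ∫ x, θ τ x * inner ℝ (V x) (Torus.gradient φ x))
      (Set.Ioc 0 T) volume :=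
    IntegrableOn.congr_set_ae iB.integral_prod_left Ioo_ae_eq_Ioc.symm
  have hD : IntegrableOn (fun τ => ∫ x, θ τ x * Torus.laplacian φ x) (Set.Ioc 0 T) volume :=
    IntegrableOn.congr_set_ae iD.integral_prod_left Ioo_ae_eq_Ioc.symm
  have hAB : IntegrableOn (fun τ => (∫ x, θ τ x *
      (inner ℝ (u τ x) (Torus.gradient φ x) + κ * Torus.laplacian φ x)) -
        ∫ x, θ τ x * inner ℝ (V x) (Torus.gradient φ x)) (Set.Ioc 0 T) volume := hA.sub hB
  have hκD : IntegrableOn (fun τ => κ * ∫ x, θ τ x * Torus.laplacian φ x) (Set.Ioc 0 T) volume :=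
    hD.const_mul κ
  have hSi : IntegrableOn (fun t => Torus.scalarL2Sq (θ t)) (Set.Ioc 0 T) volume :=
    (Torus.integrableOn_scalarL2Sq hθ hT).1
  have hlS : IntegrableOn (fun τ => lam * Torus.scalarL2Sq (θ τ)) (Set.Ioc 0 T) volume :=
    hSi.const_mul lam
  have hlW : IntegrableOn (fun τ => lam⁻¹ * ∫ x, ‖u τ x - V x‖ ^ 2) (Set.Ioc 0 T) volume :=
    hWi.const_mul lam⁻¹
  have hMi : IntegrableOn (fun τ => C / 2 * (lam * Torus.scalarL2Sq (θ τ) +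
      lam⁻¹ * ∫ x, ‖u τ x - V x‖ ^ 2)) (Set.Ioc 0 T) volume := (hlS.add hlW).const_mul (C / 2)
  -- (i) the integrand of the difference is `∫ θ ⟪u - V, ∇φ⟫` for a.e. `τ`
  have hId : ∀ᵐ τ ∂(volume.restrict (Set.Ioc 0 T)),
      (∫ x, θ τ x * (inner ℝ (u τ x) (Torus.gradient φ x) + κ * Torus.laplacian φ x)) -
        (∫ x, θ τ x * inner ℝ (V x) (Torus.gradient φ x)) -
        κ * (∫ x, θ τ x * Torus.laplacian φ x) =
      ∫ x, θ τ x * inner ℝ (u τ x - V x) (Torus.gradient φ x) := by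
    rw [← Measure.restrict_congr_set (Ioo_ae_eq_Ioc (a := (0 : ℝ)) (b := T))]
    filter_upwards [iA.prod_right_ae, iB.prod_right_ae, iD.prod_right_ae] with τ h1 h2 h3
    have h1' : Integrable (fun x => θ τ x *
        (inner ℝ (u τ x) (Torus.gradient φ x) + κ * Torus.laplacian φ x)) volume := h1
    have h2' : Integrable (fun x => θ τ x * inner ℝ (V x) (Torus.gradient φ x)) volume := h2
    have h3' : Integrable (fun x => κ * (θ τ x * Torus.laplacian φ x)) volume :=
      (h3.const_mul κ :)
    have h12 : Integrable (fun x => θ τ x *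
        (inner ℝ (u τ x) (Torus.gradient φ x) + κ * Torus.laplacian φ x) -
        θ τ x * inner ℝ (V x) (Torus.gradient φ x)) volume := h1'.sub h2'
    have hpt : (fun x => θ τ x * inner ℝ (u τ x - V x) (Torus.gradient φ x)) = fun x =>
        θ τ x * (inner ℝ (u τ x) (Torus.gradient φ x) + κ * Torus.laplacian φ x) -
          θ τ x * inner ℝ (V x) (Torus.gradient φ x) - κ * (θ τ x * Torus.laplacian φ x) := by
      funext x; rw [inner_sub_left]; ring
    rw [hpt, integral_sub h12 h3', integral_sub h1' h2', MeasureTheory.integral_const_mul]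
  -- (ii) and it is bounded by `C/2 (λ‖θ‖² + λ⁻¹ ∫‖u - V‖²)` for a.e. `τ`
  have hBd : ∀ᵐ τ ∂(volume.restrict (Set.Ioc 0 T)),
      ‖∫ x, θ τ x * inner ℝ (u τ x - V x) (Torus.gradient φ x)‖ ≤
        C / 2 * (lam * Torus.scalarL2Sq (θ τ) + lam⁻¹ * ∫ x, ‖u τ x - V x‖ ^ 2) := by
    rw [← Measure.restrict_congr_set (Ioo_ae_eq_Ioc (a := (0 : ℝ)) (b := T))]
    have hV2 : MemLp V 2 volume := hV.memLp_of_hasCompactSupport (HasCompactSupport.of_compactSpace V)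
    filter_upwards [hW.ae_memLp_two, hW.ae_memLp_two_velocity] with τ hm2 hu2
    have hθ2 : Integrable (fun x => θ τ x ^ 2) volume := hm2.integrable_sq
    have hw2m : MemLp (fun x => u τ x - V x) 2 volume := hu2.sub hV2
    have hw2 : Integrable (fun x => ‖u τ x - V x‖ ^ 2) volume :=
      (memLp_two_iff_integrable_sq_norm hw2m.1).1 hw2m
    rw [Real.norm_eq_abs]
    calc |∫ x, θ τ x * inner ℝ (u τ x - V x) (Torus.gradient φ x)|
        ≤ ∫ x, |θ τ x * inner ℝ (u τ x - V x) (Torus.gradient φ x)| := abs_integral_le_integral_abs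
      _ ≤ ∫ x, C / 2 * (lam * θ τ x ^ 2 + lam⁻¹ * ‖u τ x - V x‖ ^ 2) :=
          integral_mono_of_nonneg (Eventually.of_forall fun x => abs_nonneg _)
            (((hθ2.const_mul lam).add (hw2.const_mul lam⁻¹)).const_mul (C / 2))
            (Eventually.of_forall fun x => by
              have h1 : |inner ℝ (u τ x - V x) (Torus.gradient φ x)| ≤ ‖u τ x - V x‖ * C :=
                (abs_real_inner_le_norm _ _).trans
                  (mul_le_mul_of_nonneg_left (hC x) (norm_nonneg _))
              have h2 : 2 * (|θ τ x| * ‖u τ x - V x‖) ≤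
                  lam * θ τ x ^ 2 + lam⁻¹ * ‖u τ x - V x‖ ^ 2 := by
                rw [← sq_abs (θ τ x)]
                refine le_of_mul_le_mul_left ?_ hlam
                have e1 : lam * (lam⁻¹ * ‖u τ x - V x‖ ^ 2) = ‖u τ x - V x‖ ^ 2 := by
                  rw [← mul_assoc, mul_inv_cancel₀ hlam.ne', one_mul]
                nlinarith [sq_nonneg (lam * |θ τ x| - ‖u τ x - V x‖), e1]
              calc |θ τ x * inner ℝ (u τ x - V x) (Torus.gradient φ x)|
                  = |θ τ x| * |inner ℝ (u τ x - V x) (Torus.gradient φ x)| := abs_mul _ _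
                _ ≤ |θ τ x| * (‖u τ x - V x‖ * C) := mul_le_mul_of_nonneg_left h1 (abs_nonneg _)
                _ = C / 2 * (2 * (|θ τ x| * ‖u τ x - V x‖)) := by ring
                _ ≤ C / 2 * (lam * θ τ x ^ 2 + lam⁻¹ * ‖u τ x - V x‖ ^ 2) :=
                    mul_le_mul_of_nonneg_left h2 (by positivity))
      _ = C / 2 * (lam * Torus.scalarL2Sq (θ τ) + lam⁻¹ * ∫ x, ‖u τ x - V x‖ ^ 2) := by
          rw [MeasureTheory.integral_const_mul, integral_add (hθ2.const_mul lam) (hw2.const_mul lam⁻¹),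
            MeasureTheory.integral_const_mul, MeasureTheory.integral_const_mul, Torus.scalarL2Sq]
  -- (iii) linearity of the double integrals and the comparison
  have hL : (∫ t in (0 : ℝ)..T, ∫ τ in (0 : ℝ)..t, ∫ x, θ τ x *
          (inner ℝ (u τ x) (Torus.gradient φ x) + κ * Torus.laplacian φ x)) -
        (∫ t in (0 : ℝ)..T, ∫ τ in (0 : ℝ)..t, ∫ x, θ τ x * inner ℝ (V x) (Torus.gradient φ x)) -
        κ * (∫ t in (0 : ℝ)..T, ∫ τ in (0 : ℝ)..t, ∫ x, θ τ x * Torus.laplacian φ x) =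
      ∫ t in (0 : ℝ)..T, ∫ τ in (0 : ℝ)..t, ∫ x, θ τ x * inner ℝ (u τ x - V x) (Torus.gradient φ x) := by
    rw [← meanToolkit_double_const_mul, ← meanToolkit_double_sub hT.le hA hB,
      ← meanToolkit_double_sub hT.le hAB hκD]
    exact meanToolkit_double_congr_ae hT.le hId
  have hR : ∫ t in (0 : ℝ)..T, ∫ τ in (0 : ℝ)..t, C / 2 * (lam * Torus.scalarL2Sq (θ τ) +
        lam⁻¹ * ∫ x, ‖u τ x - V x‖ ^ 2) =
      C / 2 * (lam * (∫ t in (0 : ℝ)..T, ∫ τ in (0 : ℝ)..t, Torus.scalarL2Sq (θ τ)) +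
        lam⁻¹ * (∫ t in (0 : ℝ)..T, ∫ τ in (0 : ℝ)..t, ∫ x, ‖u τ x - V x‖ ^ 2)) := by
    rw [meanToolkit_double_const_mul, meanToolkit_double_add hT.le hlS hlW,
      meanToolkit_double_const_mul, meanToolkit_double_const_mul]
  rw [hL, ← Real.norm_eq_abs]
  exact (meanToolkit_double_norm_le hT.le hMi hBd).trans_eq hR

/-! ## The registered stub -/

/-- **Stub B — mean toolkit** (four elementary facts about the double Cesàro integral
`∫₀ᵀ∫₀ᵗ`): (B1) boundary averages of `∫θψ` are `O(T + ∫₀ᵀ‖θ‖²)`; (B2) the flux through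
`u` differs from the flux through the steady field `V` by at most
`C/2 (λ ∫∫‖θ‖² + λ⁻¹ ∫∫‖u − V‖²)`; (B3) the triangle Fubini identity
`∫₀ᵀ∫₀ᵗ F = ∫₀ᵀ (T − τ) F(τ) dτ`; (B4) `∫₀ᵀ∫₀ᵗ F ≤ T ∫₀ᵀ F` for `F ≥ 0`. [folklore] -/
theorem stub_condensateMeanToolkit :
    (∀ (κ T C : ℝ) (u : ℝ → UnitAddTorus (Fin 2) → EuclideanSpace ℝ (Fin 2))
      (h θ₀ : UnitAddTorus (Fin 2) → ℝ) (θ : ℝ → UnitAddTorus (Fin 2) → ℝ)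
      (ψ : UnitAddTorus (Fin 2) → ℝ),
      0 < T → Torus.IsWeakScalarTransportForced κ u (fun _ => h) θ₀ θ → Continuous ψ →
      (∀ x, |ψ x| ≤ C) →
      |∫ t in (0 : ℝ)..T, ∫ x, θ t x * ψ x| ≤ C * (T + ∫ t in (0 : ℝ)..T, Torus.scalarL2Sq (θ t)) / 2 ∧
      |∫ t in (0 : ℝ)..T, ∫ τ in (0 : ℝ)..t, ∫ x, θ τ x * ψ x| ≤
        T * (C * (T + ∫ t in (0 : ℝ)..T, Torus.scalarL2Sq (θ t)) / 2)) ∧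
    (∀ (κ T C lam : ℝ) (u : ℝ → UnitAddTorus (Fin 2) → EuclideanSpace ℝ (Fin 2))
      (V : UnitAddTorus (Fin 2) → EuclideanSpace ℝ (Fin 2))
      (h θ₀ : UnitAddTorus (Fin 2) → ℝ) (θ : ℝ → UnitAddTorus (Fin 2) → ℝ)
      (φ : UnitAddTorus (Fin 2) → ℝ),
      0 < T → 0 < lam → Torus.IsWeakScalarTransportForced κ u (fun _ => h) θ₀ θ → Continuous V →
      Torus.IsSmooth φ → (∀ x, ‖Torus.gradient φ x‖ ≤ C) →
      IntegrableOn (fun τ => ∫ x, ‖u τ x - V x‖ ^ 2) (Set.Ioc 0 T) →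
      |(∫ t in (0 : ℝ)..T, ∫ τ in (0 : ℝ)..t, ∫ x, θ τ x *
          (inner ℝ (u τ x) (Torus.gradient φ x) + κ * Torus.laplacian φ x)) -
        (∫ t in (0 : ℝ)..T, ∫ τ in (0 : ℝ)..t, ∫ x, θ τ x * inner ℝ (V x) (Torus.gradient φ x)) -
        κ * (∫ t in (0 : ℝ)..T, ∫ τ in (0 : ℝ)..t, ∫ x, θ τ x * Torus.laplacian φ x)| ≤
        C / 2 * (lam * (∫ t in (0 : ℝ)..T, ∫ τ in (0 : ℝ)..t, Torus.scalarL2Sq (θ τ)) +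
          lam⁻¹ * (∫ t in (0 : ℝ)..T, ∫ τ in (0 : ℝ)..t, ∫ x, ‖u τ x - V x‖ ^ 2))) ∧
    (∀ (F : ℝ → ℝ) (T : ℝ), 0 ≤ T → IntervalIntegrable F volume 0 T →
      ∫ t in (0 : ℝ)..T, ∫ τ in (0 : ℝ)..t, F τ = ∫ τ in (0 : ℝ)..T, (T - τ) * F τ) ∧
    (∀ (F : ℝ → ℝ) (T : ℝ), 0 ≤ T → IntervalIntegrable F volume 0 T → (∀ τ, 0 ≤ F τ) →
      ∫ t in (0 : ℝ)..T, ∫ τ in (0 : ℝ)..t, F τ ≤ T * ∫ τ in (0 : ℝ)..T, F τ) :=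
  ⟨meanToolkit_b1, meanToolkit_b2, meanToolkit_b3, meanToolkit_b4⟩

end Summit.AnomalousDissipation.AnomalousDissipation.Theorems.TwohalfdNeg.Condensate
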